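/-
Origin: expansion seat `planner-pub-hodgecm-pv14-g2-0`, handover 2026-08-18 (`HOME/pub-hodgecm-pv14-g2/lean/Pv14g2/PerL34/P43Leaves.lean`, md5 ba24781a, 199 lines);
landed by the gen-6 packager in gate run 22 as `HodgeCM/PerL34/P43_leaves.lean` (import ^import Pv14\.PerL34\.P43X1Bridge\b→import HodgeCM.PerL34.P43_X1bridge ×1; import ^import Pv14\.PerL34\.P43WeilModel\b→import HodgeCM.PerL34.P43_weilModel ×1).
-/
/-
Origin: HOME/pub-hodgecm-pv14-g2/lean/Pv14g2/PerL34/P43Leaves.lean — session planner-pub-hodgecm-pv14-g2-0 (unit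
pub-hodgecm-pv14-g2, DAG-NODE PROVER #14 gen 2; successor of pv14 = node N33b).  Intended final place:
`HodgeCM/PerL34/P43_leaves.lean`, AFTER (run 22) pv14's `P43WeilModel.lean` (78153823 → `HodgeCM.PerL34.P43_weilModel`,
itself after `P43Bridge` v2 e19f3b94 → `P43_bridge` and `P43Isotypic` 34a4afb0 → `P43_isotypic`) and pv14's
`P43X1Bridge.lean` (3ddb9ced → `HodgeCM.PerL34.P43_X1bridge`).
PACKAGER: the two `import Pv14.…` lines below become `import HodgeCM.PerL34.P43_weilModel` and
`import HodgeCM.PerL34.P43_X1bridge`.  KERNEL glue over pv14's shells, generic in pv02's `D : P43.LineSpanData`: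
nothing cited, nothing asserted, no new mathematics.
-/
import Summits.HodgeConjecture.HodgeCM.PerL34.P43_weilModel
import Summits.HodgeConjecture.HodgeCM.PerL34.P43_X1bridge

/-!
# N33b capstone down to its leaves: (X1) from the `K`-type record, `SomeNonzero` from `θ(φ, χ'_i) ≠ 0`

pv14's run-22 capstone `P43WeilModel.groupInputs_of_weilModel` (and pv03's S1 record `CharSpansWeil.WeilPackage M`,
whose fields are exactly its binders at `D := M.toBallSpanModel.toLineSpans.D`) still carries two COMPOSITE binders:

* `hX1 : ∀ i χ, P43Forms.ThetaPKilledByPminus FD (M i χ)` — (X1) "(f¹,f²) is annihilated by `𝔭₋`" (tex l. 652),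
  labelled INPUT(N31) + PRINT [BW] VI 4.9/4.11; pv14's `P43X1Bridge.thetaPKilledByPminus_of_KTypes` (run 22) proves it
  BY NAME from finer leaves (KERNEL Schur vanishing + PRINT [BW] VI 4.9(1),(2) / VI 4.11,(9) + INPUT(N31) +
  DEFINITIONAL slice dictionary), but takes them as eleven loose binders;
* `hne : D.SomeNonzero` — `∀ i, ∃ χ, Θ_i(χ)[𝔭₊] ≠ ⊥` at the level of pv02's slices, labelled INPUT(N30) + INPUT(N33a),
  whereas the tex (l. 648–650: "by (N33a) there is `φ ∈ 𝒮((V₃ ⊗ W_i)(𝔸))` of `K_∞`-type `𝔭₊ ⊠ 𝟏` with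
  `θ_φ(χ'_i) ≠ 0`") and pv04's N33a interface (`P43Proj.N33a_statement_iff`: `∃ φ ∈ S[𝔭₊ ⊠ 𝟏], θ φ ≠ 0`) speak of ONE
  vector of the theta-kernel model.

This file removes both composites, generically in `D`:

* `KTypeBridge FD K` — the leaves of (X1) for one theta-kernel model `K` as ONE record (fields labelled below), with
  `KTypeBridge.thetaPKilledByPminus : P43Forms.ThetaPKilledByPminus FD K` (:= pv14 `thetaPKilledByPminus_of_KTypes`);
* `thetaP_eq_bot_iff`, `someNonzero_iff_thetaNe` — under the slice dictionary `(K i χ).ThetaP = D.ThetaP i χ`,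
  pv02's `D.SomeNonzero` is EQUIVALENT (no strengthening) to `∀ i, ∃ χ, ∃ φ ∈ (K i χ).Ptype, (K i χ).theta φ ≠ 0`;
* `groupInputs_of_weilLeaves` — pv14's capstone with `hX1` replaced by `X1 : ∀ i χ, Nonempty (KTypeBridge FD (K i χ))`
  and `hne` by the N33a shape; so on the pv03 ball route the S1 record can be filled with
  `hX1 := fun i χ => (X1 i χ).thetaPKilledByPminus` and `hne := (someNonzero_iff_thetaNe D S K hK).2 hne'`
  (recipe for `CharSpansWeil.WeilPackage`; nothing of pv03's is restated here).

Verbatim anchors (PerL v5 tex, blob d912a121): l. 644–650 (Prop 4.3 proof, first paragraph: `χ'_i` of type `e(Ψ_i)`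
by L4.2(a); `Θ_i(χ'_i)` has archimedean component `J⁺`; (N33a) `φ` of type `𝔭₊ ⊠ 𝟏` with `θ_φ(χ'_i) ≠ 0`;
`Θ_i(χ'_i)[𝔭₊] ≠ 0`), l. 650–655 ((N33b): `(f¹,f²)` annihilated by `𝔭₋`, `u_f`).  No divergence from the tex.
-/

set_option autoImplicit false

noncomputable section

namespace HodgeCM
namespace PerL34
namespace P43Leaves

open HodgeCM.PerL34.P43WeilModel

/-! ### (X1) for one theta-kernel model: the `K`-type leaves as a record -/

section KType

variable {Ginf Gc Gf V S : Type*} [Group Gc] [Group Gf] [AddCommGroup V] [Module ℂ V] [AddCommGroup S]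
  [Module ℂ S]

/-- **The leaves of (X1) `ThetaPKilledByPminus FD K`** for one theta-kernel model `K` (pv14 `P43X1Bridge`, module
docstring (C1)): `R` = the ring through which `K_{ι₁}` acts (e.g. `ℂ[K_{ι₁}]`); `M₀ = F_{0,0}`, `M₁ = F_{1,1}` (simple
`K_{ι₁}`-types); `N` = the `(𝔤,K)`-module generated by `Θ_i(χ'_i)`; `P` = `𝔭₋ ⊗ Θ_i(χ'_i)[𝔭₊]` with the diagonal
`K`-action; `h₀ h₁` = PRINT [BW] VI 4.11/(9) ("`J_{i,j}|_K` contains `F_{i,j}`" and the listed `K`-types only) +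
INPUT(N31) (every constituent of `Θ_i(χ'_i)` has archimedean component `J⁺ = J_{1,0}`, tex l. 647–648); `hgen` =
PRINT [BW] VI 4.9(1),(2) (`𝔭₋ ⊗ 𝔭₊ ≅ Λ^{1,1} = F_{0,0} ⊕ F_{1,1}`) + complete reducibility of the compact `K_{ι₁}`;
`act` = SETUP, the `K`-equivariant action map `x̄ ⊗ f ↦ x̄·f`; `ι`, `hdict` = DEFINITIONAL slice dictionary (tex
l. 652–654: on the slice `(g_{ι₁}, 1, …, 1; 1_f)` the operators `R(𝔭₋)` act through the `ι₁`-variable); `hCoch` =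
DEFINITIONAL (`u_{θ(φ)}` is a `(1,0)`-cochain: `K_{ι₁}`-type `𝔭₊`, Frobenius reciprocity, smooth). -/
structure KTypeBridge (FD : P43Forms.FormsDictionary Ginf V) (K : P43Forms.ThetaKernelData Ginf Gc Gf V S) where
  /-- SETUP: the ring through which `K_{ι₁}` acts -/
  R : Type
  [iR : Ring R]
  /-- SETUP: the `K_{ι₁}`-type `F_{0,0}` -/
  M₀ : Type
  /-- SETUP: the `K_{ι₁}`-type `F_{1,1}` -/
  M₁ : Type
  /-- SETUP: the `(𝔤,K)`-module generated by `Θ_i(χ'_i)` -/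
  N : Type
  /-- SETUP: `𝔭₋ ⊗ Θ_i(χ'_i)[𝔭₊]`, diagonal `K`-action -/
  P : Type
  [iM₀ : AddCommGroup M₀] [iM₀' : Module R M₀] [iM₁ : AddCommGroup M₁] [iM₁' : Module R M₁]
  [iN : AddCommGroup N] [iN' : Module R N] [iP : AddCommGroup P] [iP' : Module R P]
  /-- PRINT ([BW] VI 4.9: `F_{i,j}` irreducible) -/
  [simple₀ : IsSimpleModule R M₀]
  /-- PRINT ([BW] VI 4.9: `F_{i,j}` irreducible) -/
  [simple₁ : IsSimpleModule R M₁]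
  /-- PRINT [BW] VI 4.11/(9) + INPUT(N31): `F_{0,0}` does not embed into `N` -/
  h₀ : P43KTypes.NoEmbedding R M₀ N
  /-- PRINT [BW] VI 4.11/(9) + INPUT(N31): `F_{1,1}` does not embed into `N` -/
  h₁ : P43KTypes.NoEmbedding R M₁ N
  /-- PRINT [BW] VI 4.9(1),(2) + complete reducibility: `P` is generated by copies of `F_{0,0}` and `F_{1,1}` -/
  hgen : P43X1Bridge.generatedBy R M₀ P ⊔ P43X1Bridge.generatedBy R M₁ P = ⊤
  /-- SETUP: the `K`-equivariant action map `x̄ ⊗ f ↦ x̄·f` -/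
  act : P →ₗ[R] N
  /-- DEFINITIONAL: the slice / packaging map `N → (τ-valued functions on U(2,1))` -/
  ι : N →+ (Ginf → V)
  /-- DEFINITIONAL (tex l. 652–654): `X u_{θ(φ)} = ι (act p)` for some `p ∈ P` -/
  hdict : ∀ X ∈ FD.Pminus, ∀ φ ∈ K.Ptype, ∃ p : P, X (P43Forms.uEval (K.theta φ)) = ι (act p)
  /-- DEFINITIONAL: `u_{θ(φ)}` is a `(1,0)`-cochain -/
  hCoch : ∀ φ ∈ K.Ptype, P43Forms.uEval (K.theta φ) ∈ FD.Cochain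

attribute [instance] KTypeBridge.iR KTypeBridge.iM₀ KTypeBridge.iM₀' KTypeBridge.iM₁ KTypeBridge.iM₁'
  KTypeBridge.iN KTypeBridge.iN' KTypeBridge.iP KTypeBridge.iP' KTypeBridge.simple₀ KTypeBridge.simple₁

/-- **(X1) BY NAME from its leaves** (pv14 `P43X1Bridge.thetaPKilledByPminus_of_KTypes`). -/
theorem KTypeBridge.thetaPKilledByPminus {FD : P43Forms.FormsDictionary Ginf V}
    {K : P43Forms.ThetaKernelData Ginf Gc Gf V S} (B : KTypeBridge FD K) :
    P43Forms.ThetaPKilledByPminus FD K :=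
  P43X1Bridge.thetaPKilledByPminus_of_KTypes FD K B.h₀ B.h₁ B.hgen B.act B.ι B.hdict B.hCoch

/-- The same from mere existence of the record. -/
theorem thetaPKilledByPminus_of_nonempty (FD : P43Forms.FormsDictionary Ginf V)
    (K : P43Forms.ThetaKernelData Ginf Gc Gf V S) (h : Nonempty (KTypeBridge FD K)) :
    P43Forms.ThetaPKilledByPminus FD K :=
  h.elim fun B => B.thetaPKilledByPminus

/-! ### `Θ_i(χ'_i)[𝔭₊] = ⊥` iff every `θ(φ)`, `φ` of type `𝔭₊ ⊠ 𝟏`, vanishes -/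

omit [Group Gc] [Group Gf] in
/-- `Θ[𝔭₊] = θ(S[𝔭₊ ⊠ 𝟏])` is `⊥` iff `θ` kills `S[𝔭₊ ⊠ 𝟏]` (pv14 `ThetaKernelData.ThetaP := Ptype.map theta`). -/
theorem thetaP_eq_bot_iff (K : P43Forms.ThetaKernelData Ginf Gc Gf V S) :
    K.ThetaP = ⊥ ↔ ∀ φ ∈ K.Ptype, K.theta φ = 0 := by
  rw [Submodule.eq_bot_iff]
  constructor
  · intro h φ hφ
    exact h _ (Submodule.mem_map.2 ⟨φ, hφ, rfl⟩)
  · intro h F hF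
    obtain ⟨φ, hφ, rfl⟩ := Submodule.mem_map.1 hF
    exact h φ hφ

end KType

/-! ### pv02's `SomeNonzero` ⇔ the N33a shape, and the capstone with leaves -/

section LineSpan

variable (D : P43.LineSpanData) (S : (i : Fin 2) → D.X i → Type) [∀ i χ, AddCommGroup (S i χ)]
  [∀ i χ, Module ℂ (S i χ)] (K : (i : Fin 2) → (χ : D.X i) → P43Forms.ThetaKernelData D.Ginf D.Gc D.Gf D.V (S i χ))

/-- **`SomeNonzero` ⇔ N30 + N33a in the tex's shape** (l. 644–650 with Lemma 4.2(a), l. 527–529): under the slice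
dictionary `Θ_i(χ)[𝔭₊] = θ(S[𝔭₊ ⊠ 𝟏])`, "for each `i` some `Θ_i(χ)[𝔭₊] ≠ 0`" iff "for each `i` there are a character
`χ'_i` (of type `e(Ψ_i)`, N30) and a `φ` of `K_∞`-type `𝔭₊ ⊠ 𝟏` with `F_{θ(φ,χ'_i)} ≠ 0` (N33a)". -/
theorem someNonzero_iff_thetaNe (hK : ∀ i χ, (K i χ).ThetaP = D.ThetaP i χ) :
    D.SomeNonzero ↔ ∀ i : Fin 2, ∃ χ : D.X i, ∃ φ ∈ (K i χ).Ptype, (K i χ).theta φ ≠ 0 := by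
  show (∀ i : Fin 2, ∃ χ : D.X i, D.ThetaP i χ ≠ ⊥) ↔ _
  refine forall_congr' fun i => exists_congr fun χ => ?_
  rw [← hK i χ]
  constructor
  · intro h
    by_contra hcon
    push Not at hcon
    exact h ((thetaP_eq_bot_iff (K i χ)).2 hcon)
  · rintro ⟨φ, hφ, hθ⟩ hbot
    exact hθ ((thetaP_eq_bot_iff (K i χ)).1 hbot φ hφ)

/-- **N33b capstone with leaves**: pv14's `groupInputs_of_weilModel` with (X1) supplied per datum by a `KTypeBridge`
record and `SomeNonzero` by the N33a shape.  The remaining binders are pv14's: the forms dictionary with the same `Hol`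
(SETUP D2/D6 + DEFINITIONAL), one `WeilTyping` per `(i, χ)` (DEFINITIONAL `Θ`/`hθ`/`hP`, PRINT `hmul*`/`hcomm*`,
tex l. 262 / l. 342), N10 in invariant form (`hΘ`, INPUT(N10) / PRINT automorphy of the theta distribution), (X2)
(PRINT-DERIVED [BW] II 4.2 (6) + VII 2.5/2.7). -/
theorem groupInputs_of_weilLeaves (hK : ∀ i χ, (K i χ).ThetaP = D.ThetaP i χ)
    (FD : P43Forms.FormsDictionary D.Ginf D.V) (hHol : FD.Hol = D.Hol)
    {Kc P : Type} [AddCommGroup P] [Module ℂ P] (ρP : Kc → P →ₗ[ℂ] P)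
    (ωinf : (i : Fin 2) → (χ : D.X i) → D.Ginf → S i χ →ₗ[ℂ] S i χ)
    (ρ : (i : Fin 2) → (χ : D.X i) → Kc → S i χ →ₗ[ℂ] S i χ)
    (W : ∀ i χ, WeilTyping (K i χ) (ωinf i χ) (ρ i χ) ρP)
    (hΘ : ∀ i χ, ∀ γ ∈ D.Γ,
      (W i χ).Θ ∘ₗ (ωinf i χ γ.1 ∘ₗ (K i χ).ωc γ.2.1 ∘ₗ (K i χ).ωf γ.2.2) = (W i χ).Θ)
    (X1 : ∀ i χ, Nonempty (KTypeBridge FD (K i χ))) (hX2 : P43Forms.HolomorphicOfPminus FD)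
    (hne : ∀ i : Fin 2, ∃ χ : D.X i, ∃ φ ∈ (K i χ).Ptype, (K i χ).theta φ ≠ 0) :
    D.LeftInvariant ∧ D.CompactInvariant ∧ D.FiniteStable ∧ D.UHolomorphic ∧ D.SomeNonzero :=
  groupInputs_of_weilModel D FD hHol S K hK ρP ωinf ρ W hΘ
    (fun i χ => thetaPKilledByPminus_of_nonempty FD (K i χ) (X1 i χ)) hX2
    ((someNonzero_iff_thetaNe D S K hK).2 hne)

/-- N33b itself (pv14 `P43Forms.N33b_statement`, tex l. 650–657) for every datum, from the same leaves — for the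
record: the node is a CONSEQUENCE of the leaves, not an input of the route. -/
theorem n33b_of_weilLeaves (FD : P43Forms.FormsDictionary D.Ginf D.V)
    {Kc P : Type} [AddCommGroup P] [Module ℂ P] (ρP : Kc → P →ₗ[ℂ] P)
    (ωinf : (i : Fin 2) → (χ : D.X i) → D.Ginf → S i χ →ₗ[ℂ] S i χ)
    (ρ : (i : Fin 2) → (χ : D.X i) → Kc → S i χ →ₗ[ℂ] S i χ)
    (W : ∀ i χ, WeilTyping (K i χ) (ωinf i χ) (ρ i χ) ρP)
    (hΘ : ∀ i χ, ∀ γ ∈ D.Γ,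
      (W i χ).Θ ∘ₗ (ωinf i χ γ.1 ∘ₗ (K i χ).ωc γ.2.1 ∘ₗ (K i χ).ωf γ.2.2) = (W i χ).Θ)
    (X1 : ∀ i χ, Nonempty (KTypeBridge FD (K i χ))) (hX2 : P43Forms.HolomorphicOfPminus FD)
    (i : Fin 2) (χ : D.X i) : P43Forms.N33b_statement FD (K i χ) D.Γ :=
  P43Forms.N33b_of FD (K i χ) D.Γ (thetaPKilledByPminus_of_nonempty FD (K i χ) (X1 i χ)) hX2
    ((W i χ).leftInvariant D.Γ (hΘ i χ)) (W i χ).thetaEquivariantC (W i χ).ptypeFixedC (W i χ).thetaEquivariantF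
    (W i χ).ptypeStableF

end LineSpan

end P43Leaves
end PerL34
end HodgeCM

end
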